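import Summits.QuantumFields.YangMills.Theorems.LuscherReductionTwistedTraceScalingCombPropagation
import HarnessLib

/-!
# COMB-GAUGE PROPAGATION, layer 3: the three WRAP families are almost constant across their transverse planes and their representatives ALMOST COMMUTE
# (lane A of S-BASE, crux `TwistedTraceScaling` stmt-QuantumFields-20203; toward `ValleyLinkProxAt`, design note `pub/ym-fleet/ym-luscher-20007-p1/COARSE-DESIGN.md` §16)

`V = treeFix U`, `ε₁ = √(2S(U))`.  Representatives of the three wrap families: `h₀ = V((−1,0,0),0)`, `h₁ = V((0,−1,0),1)`, `h₂ = V((0,0,−1),2)`.  Layer 2 (`…CombPropagation`) put every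
non-wrap link within `2(L−1)ε₁` of `1` and every direction-`0`/`1` wrap link within `2(L−1)ε₁` of the wrap link of its base line.  Here, transporting along the boundary layers
with `frobNorm_line_sub_le'` (`…CombTransport`):
* `fd_wrap1_rep_le` — the direction-`1` base-line wrap links `V((a,−1,0),1)` are within `(L−1)(4L−3)ε₁` of `h₁`; hence ★ `fd_treeFix_wrap1_h1_le`: EVERY direction-`1` wrap link is within
  `(L−1)(4L−2)ε₁` of `h₁`; ★ `fd_treeFix_wrap0_h0_le` (layer 2, renamed): every direction-`0` wrap link within `2(L−1)ε₁` of `h₀`;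
* `fd_wrap2_col_le`, `fd_wrap2_row_le`, ★ `fd_treeFix_wrap2_h2_le` — every direction-`2` wrap link `V((a,b,−1),2)` is within `(L−1)(6L−4)ε₁` of `h₂`;
* ★★ `frobNorm_comm_reps_le` — the three boundary plaquettes through the corner give `‖hᵢhⱼhᵢ⁻¹hⱼ⁻¹ − 1‖_F ≤ C_L·ε₁` for the three pairs, with explicit `C_L = O(L²)`;
  `cross_le_of_comm` converts to the defect currency of `…AlmostCommutingSU2` (`|uᵢ × uⱼ| ≤ ‖comm − 1‖/2`).
So `treeFix U` is, link by link, within `O(L²)·√(2S(U))` of the COMB-FLAT configuration with wrap values `(h₀,h₁,h₂)`, which almost commute with defects `O(L²)√(2S)`; layer 4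
(successor) replaces them by an exactly commuting common-axis triple (`exists_common_axis_triple_near`, cost `O(L)·(2S)^{1/4}`) and identifies the result with `g·abelianCfg θ`.
HONEST FRAMING: bookkeeping on the discrete torus for a stub lane of a child of the CONDITIONAL reduction route (femto rung R2b1); not a gap, not Clay.
-/

set_option autoImplicit false

noncomputable section

open Matrix Real
open scoped Matrix BigOperators
open Literature.MathematicalPhysics.QuantumFieldTheory
open Literature.MathematicalPhysics.QuantumLattice

namespace Summit.QuantumFields.YangMills.Theorems.FemtoTransferGap.TwoLattice.Flat

open Summit.QuantumFields.YangMills.Theorems.FemtoTransferGap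
open Summit.QuantumFields.YangMills.Theorems.FemtoTransferGap.TwoLattice

variable {L : ℕ} [NeZero L]

/-! ## §1 The boundary base sites -/

/-- The site `(a, b, c)`. [folklore] -/
def mk3 (a b c : ZMod L) : Site 3 L := ![a, b, c]

omit [NeZero L] in
/-- Coordinate `0` of `mk3`. [folklore] -/
@[simp] theorem mk3_zero (a b c : ZMod L) : mk3 a b c 0 = a := rfl
omit [NeZero L] in
/-- Coordinate `1` of `mk3`. [folklore] -/
@[simp] theorem mk3_one (a b c : ZMod L) : mk3 a b c 1 = b := rfl
omit [NeZero L] in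
/-- Coordinate `2` of `mk3`. [folklore] -/
@[simp] theorem mk3_two (a b c : ZMod L) : mk3 a b c 2 = c := rfl

omit [NeZero L] in
/-- Every site is `mk3` of its coordinates. [folklore] -/
theorem eq_mk3 (z : Site 3 L) : z = mk3 (z 0) (z 1) (z 2) := by
  funext j; fin_cases j <;> rfl

omit [NeZero L] in
/-- Lines in direction `0` from `mk3 a b c`. [folklore] -/
theorem lineSite_mk3_zero (a b c : ZMod L) (m : ℕ) : lineSite (mk3 a b c) 0 m = mk3 (a + ((m : ℕ) : ZMod L)) b c := by
  funext j; fin_cases j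
  · exact lineSite_apply_self _ _ _
  · exact lineSite_apply_ne _ (by decide) _
  · exact lineSite_apply_ne _ (by decide) _

omit [NeZero L] in
/-- Lines in direction `1` from `mk3 a b c`. [folklore] -/
theorem lineSite_mk3_one (a b c : ZMod L) (m : ℕ) : lineSite (mk3 a b c) 1 m = mk3 a (b + ((m : ℕ) : ZMod L)) c := by
  funext j; fin_cases j
  · exact lineSite_apply_ne _ (by decide) _
  · exact lineSite_apply_self _ _ _
  · exact lineSite_apply_ne _ (by decide) _

omit [NeZero L] in
/-- Shifts of `mk3`. [folklore] -/
theorem mk3_shift (a b c : ZMod L) (i : Fin 3) :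
    (mk3 a b c).shift i = mk3 (if i = 0 then a + 1 else a) (if i = 1 then b + 1 else b) (if i = 2 then c + 1 else c) := by
  funext j
  rw [Site.shift, Pi.add_apply]
  fin_cases i <;> fin_cases j <;> simp [mk3]

omit [NeZero L] in
/-- `base2 z = mk3 (z 0) (z 1) 0`. [folklore] -/
theorem base2_eq_mk3 (z : Site 3 L) : base2 z = mk3 (z 0) (z 1) 0 := by
  funext j; rw [base2_apply]; fin_cases j <;> simp

omit [NeZero L] in
/-- `base1 z = mk3 (z 0) 0 0`. [folklore] -/
theorem base1_eq_mk3 (z : Site 3 L) : base1 z = mk3 (z 0) 0 0 := by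
  funext j; rw [base1_apply]; fin_cases j <;> simp

section Comb

variable (U : GaugeConfig 3 L SU2)


/-! ## §2 The direction-`1` wrap family is almost constant along the base line -/

/-- ★ The base-line wrap links `V((a,−1,0),1)` are within `a.val·(4L−3)ε₁` of `h₁ = V((0,−1,0),1)`. [cite: Luscher1983, §2] -/
theorem fd_wrap1_rep_le (a : ZMod L) :
    fd (treeFix U (mk3 a (-1) 0, 1)) (treeFix U (mk3 0 (-1) 0, 1)) ≤ a.val * (Real.sqrt (2 * wilsonAction su2Rep U) + 2 * (2 * ((L : ℝ) - 1) * Real.sqrt (2 * wilsonAction su2Rep U))) := by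
  have h := frobNorm_line_sub_le' (treeFix U) (mk3 0 (-1) 0) 0 1 (ε := Real.sqrt (2 * wilsonAction su2Rep U)) (a := 2 * ((L : ℝ) - 1) * Real.sqrt (2 * wilsonAction su2Rep U)) a.val
    (fun m _ => hol_treeFix_le U _ 0 1 (by decide)) (fun m hm => ?_)
  · rw [lineSite_mk3_zero, zero_add, natCast_val_eq] at h; exact h
  · have hm' : ((m : ℕ) : ZMod L) ≠ -1 := natCast_ne_neg_one_of_lt_val hm
    rw [lineSite_mk3_zero, zero_add, mk3_shift]
    simp only [Fin.isValue, if_false, if_true, Fin.reduceEq]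
    exact ⟨fd_treeFix_zero_le U (by simpa using hm'), fd_treeFix_zero_le U (by simpa using hm')⟩

/-- ★ **Every direction-`1` wrap link is within `(L−1)(4L−2)ε₁` of `h₁`.** [cite: Luscher1983, §2] -/
theorem fd_treeFix_wrap1_h1_le {z : Site 3 L} (hz : z 1 = -1) :
    fd (treeFix U (z, 1)) (treeFix U (mk3 0 (-1) 0, 1)) ≤ ((L : ℝ) - 1) * ((4 * (L : ℝ) - 2) * Real.sqrt (2 * wilsonAction su2Rep U)) := by
  have h1 := fd_treeFix_wrap1_le U z
  have h2 := fd_wrap1_rep_le U (z 0)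
  rw [base2_eq_mk3, hz] at h1
  have hv := val_le_pred (z 0)
  have hs : 0 ≤ Real.sqrt (2 * wilsonAction su2Rep U) := Real.sqrt_nonneg _
  have hL : (1 : ℝ) ≤ L := by exact_mod_cast NeZero.one_le
  calc fd (treeFix U (z, 1)) (treeFix U (mk3 0 (-1) 0, 1))
      ≤ fd (treeFix U (z, 1)) (treeFix U (mk3 (z 0) (-1) 0, 1)) + fd (treeFix U (mk3 (z 0) (-1) 0, 1)) (treeFix U (mk3 0 (-1) 0, 1)) :=
        fd_triangle _ (treeFix U (mk3 (z 0) (-1) 0, 1)) _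
    _ ≤ ((L : ℝ) - 1) * Real.sqrt (2 * wilsonAction su2Rep U) + ((L : ℝ) - 1) * (Real.sqrt (2 * wilsonAction su2Rep U) + 2 * (2 * ((L : ℝ) - 1) * Real.sqrt (2 * wilsonAction su2Rep U))) :=
        add_le_add h1 (h2.trans (mul_le_mul_of_nonneg_right hv (by positivity)))
    _ = ((L : ℝ) - 1) * ((4 * (L : ℝ) - 2) * Real.sqrt (2 * wilsonAction su2Rep U)) := by ring

/-- ★ **Every direction-`0` wrap link is within `2(L−1)ε₁` of `h₀ = V((−1,0,0),0)`.** [cite: Luscher1983, §2] -/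
theorem fd_treeFix_wrap0_h0_le {z : Site 3 L} (hz : z 0 = -1) :
    fd (treeFix U (z, 0)) (treeFix U (mk3 (-1) 0 0, 0)) ≤ 2 * ((L : ℝ) - 1) * Real.sqrt (2 * wilsonAction su2Rep U) := by
  have h := fd_treeFix_wrap0_le U z
  rwa [base1_eq_mk3, base2_apply, if_neg (by decide), hz] at h

/-! ## §3 The direction-`2` wrap family is almost constant over the top layer -/

/-- Along a column `b ↦ (a,b,−1)`: `V((a,b,−1),2)` within `b.val·(2L−1)ε₁` of `V((a,0,−1),2)`. [cite: Luscher1983, §2] -/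
theorem fd_wrap2_col_le (a b : ZMod L) :
    fd (treeFix U (mk3 a b (-1), 2)) (treeFix U (mk3 a 0 (-1), 2)) ≤ b.val * (Real.sqrt (2 * wilsonAction su2Rep U) + 2 * (((L : ℝ) - 1) * Real.sqrt (2 * wilsonAction su2Rep U))) := by
  have h := frobNorm_line_sub_le' (treeFix U) (mk3 a 0 (-1)) 1 2 (ε := Real.sqrt (2 * wilsonAction su2Rep U)) (a := ((L : ℝ) - 1) * Real.sqrt (2 * wilsonAction su2Rep U)) b.val
    (fun m _ => hol_treeFix_le U _ 1 2 (by decide)) (fun m hm => ?_)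
  · rw [lineSite_mk3_one, zero_add, natCast_val_eq] at h; exact h
  · have hm' : ((m : ℕ) : ZMod L) ≠ -1 := natCast_ne_neg_one_of_lt_val hm
    rw [lineSite_mk3_one, zero_add, mk3_shift]
    simp only [Fin.isValue, Fin.reduceEq, if_false, if_true]
    exact ⟨fd_treeFix_one_le U (by simpa using hm'), fd_treeFix_one_le U (by simpa using hm')⟩

/-- Along the row `a ↦ (a,0,−1)`: `V((a,0,−1),2)` within `a.val·(4L−3)ε₁` of `h₂ = V((0,0,−1),2)`. [cite: Luscher1983, §2] -/
theorem fd_wrap2_row_le (a : ZMod L) :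
    fd (treeFix U (mk3 a 0 (-1), 2)) (treeFix U (mk3 0 0 (-1), 2)) ≤ a.val * (Real.sqrt (2 * wilsonAction su2Rep U) + 2 * (2 * ((L : ℝ) - 1) * Real.sqrt (2 * wilsonAction su2Rep U))) := by
  have h := frobNorm_line_sub_le' (treeFix U) (mk3 0 0 (-1)) 0 2 (ε := Real.sqrt (2 * wilsonAction su2Rep U)) (a := 2 * ((L : ℝ) - 1) * Real.sqrt (2 * wilsonAction su2Rep U)) a.val
    (fun m _ => hol_treeFix_le U _ 0 2 (by decide)) (fun m hm => ?_)
  · rw [lineSite_mk3_zero, zero_add, natCast_val_eq] at h; exact h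
  · have hm' : ((m : ℕ) : ZMod L) ≠ -1 := natCast_ne_neg_one_of_lt_val hm
    rw [lineSite_mk3_zero, zero_add, mk3_shift]
    simp only [Fin.isValue, if_false, if_true, Fin.reduceEq]
    exact ⟨fd_treeFix_zero_le U (by simpa using hm'), fd_treeFix_zero_le U (by simpa using hm')⟩

/-- ★ **Every direction-`2` wrap link is within `(L−1)(6L−4)ε₁` of `h₂`.** [cite: Luscher1983, §2] -/
theorem fd_treeFix_wrap2_h2_le {z : Site 3 L} (hz : z 2 = -1) :
    fd (treeFix U (z, 2)) (treeFix U (mk3 0 0 (-1), 2)) ≤ ((L : ℝ) - 1) * ((6 * (L : ℝ) - 4) * Real.sqrt (2 * wilsonAction su2Rep U)) := by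
  have hz' : z = mk3 (z 0) (z 1) (-1) := by rw [← hz]; exact eq_mk3 z
  have h1 := fd_wrap2_col_le U (z 0) (z 1)
  have h2 := fd_wrap2_row_le U (z 0)
  have hv0 := val_le_pred (z 0)
  have hv1 := val_le_pred (z 1)
  have hs : 0 ≤ Real.sqrt (2 * wilsonAction su2Rep U) := Real.sqrt_nonneg _
  have hL : (1 : ℝ) ≤ L := by exact_mod_cast NeZero.one_le
  rw [hz']
  calc fd (treeFix U (mk3 (z 0) (z 1) (-1), 2)) (treeFix U (mk3 0 0 (-1), 2))
      ≤ fd (treeFix U (mk3 (z 0) (z 1) (-1), 2)) (treeFix U (mk3 (z 0) 0 (-1), 2)) + fd (treeFix U (mk3 (z 0) 0 (-1), 2)) (treeFix U (mk3 0 0 (-1), 2)) :=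
        fd_triangle _ (treeFix U (mk3 (z 0) 0 (-1), 2)) _
    _ ≤ ((L : ℝ) - 1) * (Real.sqrt (2 * wilsonAction su2Rep U) + 2 * (((L : ℝ) - 1) * Real.sqrt (2 * wilsonAction su2Rep U))) + ((L : ℝ) - 1) * (Real.sqrt (2 * wilsonAction su2Rep U) + 2 * (2 * ((L : ℝ) - 1) * Real.sqrt (2 * wilsonAction su2Rep U))) :=
        add_le_add (h1.trans (mul_le_mul_of_nonneg_right hv1 (by positivity))) (h2.trans (mul_le_mul_of_nonneg_right hv0 (by positivity)))
    _ = ((L : ℝ) - 1) * ((6 * (L : ℝ) - 4) * Real.sqrt (2 * wilsonAction su2Rep U)) := by ring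

/-! ## §4 The representatives almost commute -/

omit [NeZero L] in
/-- `fd` of inverses. [folklore] -/
theorem fd_inv (C C' : SU2) : fd C⁻¹ C'⁻¹ = fd C C' := by
  have h : fd C⁻¹ C'⁻¹ = fd (C * C⁻¹ * C') (C * C'⁻¹ * C') := by rw [← fd_mul_left C, ← fd_mul_right C']
  rw [h, mul_inv_cancel, one_mul, mul_assoc, inv_mul_cancel, mul_one, fd_comm]

omit [NeZero L] in
/-- Perturbing three letters of the plaquette word `A·X·C⁻¹·B⁻¹`. [folklore] -/
theorem fd_word_le (A X C B A' C' B' : SU2) :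
    fd (A * X * C⁻¹ * B⁻¹) (A' * X * C'⁻¹ * B'⁻¹) ≤ fd A A' + fd C C' + fd B B' := by
  have h1 : fd (A * X * C⁻¹ * B⁻¹) (A' * X * C⁻¹ * B⁻¹) = fd A A' := by
    rw [show A * X * C⁻¹ * B⁻¹ = A * (X * C⁻¹ * B⁻¹) by group, show A' * X * C⁻¹ * B⁻¹ = A' * (X * C⁻¹ * B⁻¹) by group, fd_mul_right]
  have h2 : fd (A' * X * C⁻¹ * B⁻¹) (A' * X * C'⁻¹ * B⁻¹) = fd C C' := by
    rw [show A' * X * C⁻¹ * B⁻¹ = (A' * X) * C⁻¹ * B⁻¹ by group, show A' * X * C'⁻¹ * B⁻¹ = (A' * X) * C'⁻¹ * B⁻¹ by group,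
      fd_mul_right, fd_mul_left, fd_inv]
  have h3 : fd (A' * X * C'⁻¹ * B⁻¹) (A' * X * C'⁻¹ * B'⁻¹) = fd B B' := by
    rw [fd_mul_left, fd_inv]
  calc fd (A * X * C⁻¹ * B⁻¹) (A' * X * C'⁻¹ * B'⁻¹)
      ≤ fd (A * X * C⁻¹ * B⁻¹) (A' * X * C⁻¹ * B⁻¹) + fd (A' * X * C⁻¹ * B⁻¹) (A' * X * C'⁻¹ * B'⁻¹) := fd_triangle _ (A' * X * C⁻¹ * B⁻¹) _
    _ ≤ fd A A' + (fd (A' * X * C⁻¹ * B⁻¹) (A' * X * C'⁻¹ * B⁻¹) + fd (A' * X * C'⁻¹ * B⁻¹) (A' * X * C'⁻¹ * B'⁻¹)) := by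
        rw [h1]; exact add_le_add le_rfl (fd_triangle _ (A' * X * C'⁻¹ * B⁻¹) _)
    _ = fd A A' + fd C C' + fd B B' := by rw [h2, h3]; ring

omit [NeZero L] in
/-- From a plaquette `A X C⁻¹ B⁻¹` within `ε` of `1` to the commutator `A' X C'⁻¹ B'⁻¹` within `ε + (perturbations)` of `1`. [folklore] -/
theorem fd_comm_one_le {A X C B A' C' B' : SU2} {ε : ℝ} (hhol : frobNorm ((((A * X * C⁻¹ * B⁻¹ : SU2)) : Matrix (Fin 2) (Fin 2) ℂ) - 1) ≤ ε) :
    fd (A' * X * C'⁻¹ * B'⁻¹) 1 ≤ ε + (fd A A' + fd C C' + fd B B') := by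
  have h := fd_word_le A X C B A' C' B'
  rw [fd_comm] at h
  have h1 : fd (A * X * C⁻¹ * B⁻¹) 1 ≤ ε := by rw [fd_one]; exact hhol
  calc fd (A' * X * C'⁻¹ * B'⁻¹) 1 ≤ fd (A' * X * C'⁻¹ * B'⁻¹) (A * X * C⁻¹ * B⁻¹) + fd (A * X * C⁻¹ * B⁻¹) 1 := fd_triangle _ (A * X * C⁻¹ * B⁻¹) _
    _ ≤ (fd A A' + fd C C' + fd B B') + ε := add_le_add h h1
    _ = ε + (fd A A' + fd C C' + fd B B') := by ring

/-- ★★ **`h₀` and `h₁` almost commute**: `‖h₀h₁h₀⁻¹h₁⁻¹ − 1‖_F ≤ (1 + 2(L−1) + (L−1)(4L−2))·ε₁` (boundary plaquette `(0,1)` at `(−1,−1,0)`). [cite: Luscher1983, §2] -/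
theorem fd_comm01_le :
    fd (treeFix U (mk3 (-1) 0 0, 0) * treeFix U (mk3 0 (-1) 0, 1) * (treeFix U (mk3 (-1) 0 0, 0))⁻¹ * (treeFix U (mk3 0 (-1) 0, 1))⁻¹) 1 ≤
      Real.sqrt (2 * wilsonAction su2Rep U) + (2 * ((L : ℝ) - 1) * Real.sqrt (2 * wilsonAction su2Rep U) + 0 + ((L : ℝ) - 1) * ((4 * (L : ℝ) - 2) * Real.sqrt (2 * wilsonAction su2Rep U))) := by
  -- the plaquette `(0,1)` at `x = (−1,−1,0)`: `V(x,0)·V(x+e₀,1)·V(x+e₁,0)⁻¹·V(x,1)⁻¹`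
  have hhol := hol_treeFix_le U (mk3 (-1) (-1) 0) 0 1 (by decide)
  have e0 : (mk3 (-1 : ZMod L) (-1) 0).shift 0 = mk3 0 (-1) 0 := by rw [mk3_shift]; simp
  have e1 : (mk3 (-1 : ZMod L) (-1) 0).shift 1 = mk3 (-1) 0 0 := by rw [mk3_shift]; simp
  unfold plaquetteHolonomy at hhol
  rw [e0, e1] at hhol
  refine (fd_comm_one_le hhol).trans (add_le_add le_rfl (add_le_add (add_le_add ?_ ?_) ?_))
  · exact fd_treeFix_wrap0_h0_le U (by simp)
  · rw [fd_self]
  · exact fd_treeFix_wrap1_h1_le U (by simp)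

/-- ★★ **`h₁` and `h₂` almost commute**: boundary plaquette `(1,2)` at `(0,−1,−1)`. [cite: Luscher1983, §2] -/
theorem fd_comm12_le :
    fd (treeFix U (mk3 0 (-1) 0, 1) * treeFix U (mk3 0 0 (-1), 2) * (treeFix U (mk3 0 (-1) 0, 1))⁻¹ * (treeFix U (mk3 0 0 (-1), 2))⁻¹) 1 ≤
      Real.sqrt (2 * wilsonAction su2Rep U) + (((L : ℝ) - 1) * ((4 * (L : ℝ) - 2) * Real.sqrt (2 * wilsonAction su2Rep U)) + 0 + ((L : ℝ) - 1) * ((6 * (L : ℝ) - 4) * Real.sqrt (2 * wilsonAction su2Rep U))) := by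
  have hhol := hol_treeFix_le U (mk3 0 (-1) (-1)) 1 2 (by decide)
  have e1 : (mk3 (0 : ZMod L) (-1) (-1)).shift 1 = mk3 0 0 (-1) := by rw [mk3_shift]; simp
  have e2 : (mk3 (0 : ZMod L) (-1) (-1)).shift 2 = mk3 0 (-1) 0 := by rw [mk3_shift]; simp
  unfold plaquetteHolonomy at hhol
  rw [e1, e2] at hhol
  refine (fd_comm_one_le hhol).trans (add_le_add le_rfl (add_le_add (add_le_add ?_ ?_) ?_))
  · exact fd_treeFix_wrap1_h1_le U (by simp)
  · rw [fd_self]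
  · exact fd_treeFix_wrap2_h2_le U (by simp)

/-- ★★ **`h₀` and `h₂` almost commute**: boundary plaquette `(0,2)` at `(−1,0,−1)`. [cite: Luscher1983, §2] -/
theorem fd_comm02_le :
    fd (treeFix U (mk3 (-1) 0 0, 0) * treeFix U (mk3 0 0 (-1), 2) * (treeFix U (mk3 (-1) 0 0, 0))⁻¹ * (treeFix U (mk3 0 0 (-1), 2))⁻¹) 1 ≤
      Real.sqrt (2 * wilsonAction su2Rep U) + (2 * ((L : ℝ) - 1) * Real.sqrt (2 * wilsonAction su2Rep U) + 0 + ((L : ℝ) - 1) * ((6 * (L : ℝ) - 4) * Real.sqrt (2 * wilsonAction su2Rep U))) := by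
  have hhol := hol_treeFix_le U (mk3 (-1) 0 (-1)) 0 2 (by decide)
  have e0 : (mk3 (-1 : ZMod L) 0 (-1)).shift 0 = mk3 0 0 (-1) := by rw [mk3_shift]; simp
  have e2 : (mk3 (-1 : ZMod L) 0 (-1)).shift 2 = mk3 (-1) 0 0 := by rw [mk3_shift]; simp
  unfold plaquetteHolonomy at hhol
  rw [e0, e2] at hhol
  refine (fd_comm_one_le hhol).trans (add_le_add le_rfl (add_le_add (add_le_add ?_ ?_) ?_))
  · exact fd_treeFix_wrap0_h0_le U (by simp)
  · rw [fd_self]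
  · exact fd_treeFix_wrap2_h2_le U (by simp)

end Comb

/-! ## §5 From the commutator to the cross-product defect of `…AlmostCommutingSU2` -/

omit [NeZero L] in
/-- `‖ABA⁻¹B⁻¹ − 1‖_F² = 8|u_A × u_B|²`. [cite: BrockerTomDieck1985, I (1.10)] -/
theorem fd_comm_one_sq (A B : SU2) : fd (A * B * A⁻¹ * B⁻¹) 1 ^ 2 = 8 * ((vecPart A ⨯₃ vecPart B) ⬝ᵥ (vecPart A ⨯₃ vecPart B)) := by
  rw [fd_one, frobNorm_sub_one_sq_eq_scalarPart]
  have h := two_sub_re_trace_comm_eq_cross A B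
  rw [re_trace_eq_two_mul_scalarPart] at h
  linarith

omit [NeZero L] in
/-- ★ The cross defect is at most half the commutator distance: `|u_A × u_B| ≤ ‖ABA⁻¹B⁻¹ − 1‖_F / 2`. [folklore] -/
theorem cross_le_of_comm (A B : SU2) :
    Real.sqrt ((vecPart A ⨯₃ vecPart B) ⬝ᵥ (vecPart A ⨯₃ vecPart B)) ≤ fd (A * B * A⁻¹ * B⁻¹) 1 / 2 := by
  have h := fd_comm_one_sq A B
  have h0 : 0 ≤ fd (A * B * A⁻¹ * B⁻¹) 1 := frobNorm_nonneg _
  rw [Real.sqrt_le_left (by positivity)]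
  nlinarith

end Summit.QuantumFields.YangMills.Theorems.FemtoTransferGap.TwoLattice.Flat

end
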